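import Mathlib
import Summits.ABC.ABC.Theorems.SoloInformedOnePrime

/-!
# Solo (informed) — the one-prime face through the subgroup `⟨2⟩ ⊂ (ℤ/p)ˣ`

The one-prime prediction of abc (face (F5) of `soloInformed_onePrime_of_abc`) reads
`(W(p) - 1)·log p ≤ ε·e_p·log 2 + K_ε`, where `W(p) = v_p(2^(p-1)-1)` and `e_p = ord_p(2)`.
The only unconditional engine is Yamada's two-`p`-adic-logarithm bound
`W(p) ≤ 557.2·p/(log p)^2 + 4`, which settles (F5) exactly on the primes of bounded residual index
`i_p = (p-1)/e_p` (`soloInformed_onePrime_boundedIndex_of_twoLogBound`).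

This file isolates the *combinatorial* half of a sharpening and proves it in the kernel:

* `soloInformed_exists_quotient_in_zpowers_two` — pigeonhole in `(ℤ/p)ˣ/⟨2⟩`: among the `2^m`
  sub-products of `m` units, two are congruent modulo `⟨2⟩` as soon as `2^m > i_p`;
* `soloInformed_exists_dyadic_odd_primes` — Bertrand's postulate supplies `m` distinct odd primes
  `q_j ∈ (2^(j+1), 2^(j+2)]`, so their product is `≤ 2^(m(m+3)/2)`;
* `soloInformed_wieferichExp_le_of_subgroupTwoLogBound` — hence ANY two-logarithm bound for pairs
  `(2u/v, u/v)` with `u/v ∈ ⟨2⟩ (mod p)` whose main term carries the factor `ord_p(2)` (instead of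
  `p - 1`) bounds `W(p)` by `C·e_p·(log Q)(log 2Q)/(log p)^2 + C'` with `log Q = O((log i_p)^2)`;
* (in `SoloInformedOnePrimeGrowingIndex`) `soloInformed_onePrime_growingIndex_of_subgroupTwoLogBound`
  — and therefore settles (F5) on the set of primes with `(log i_p)^4 ≤ δ_ε · log p`, a set of
  *growing* index.

The analytic input — the subgroup-restricted two-logarithm bound itself, hypothesis `hH` below, a
sharpening of Bugeaud–Laurent (J. Number Theory 61 (1996), Thm 1) / Yamada (arXiv:math/0607072,
Thm 1.1) in which the loss `γ_j` is replaced by `(R_j - 1)/(2 R_j) < 1/2` — is NOT formalised here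
(Baker's method is not in Mathlib); it is stated as an explicit hypothesis with free constants
`C, C'` and proved on paper (solo-informed paper, §2.3, with `C = 100`, `C' = 254`).
No abc-specific definitions are introduced; everything is stated over Mathlib notions.
-/

namespace Summit.ABC.ABC.Theorems

open Finset

/-- **Pigeonhole in `(ℤ/p)ˣ/⟨2⟩`.** If `q₀,…,q_{m-1}` are units mod `p` and `2^m·ord_p(2) > p-1`
(i.e. `2^m` exceeds the residual index of `2`), then two distinct sub-products of the `q_j` differ
multiplicatively by a power of `2` modulo `p`. -/
theorem soloInformed_exists_quotient_in_zpowers_two {p : ℕ} (hp : p.Prime)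
    {m : ℕ} (q : Fin m → ℕ) (hq0 : ∀ j, (q j : ZMod p) ≠ 0)
    (hcard : p - 1 < 2 ^ m * orderOf (2 : ZMod p)) :
    ∃ S T : Finset (Fin m), S ≠ T ∧ ∃ k : ℕ,
      (2 : ZMod p) ^ k * (∏ j ∈ T, (q j : ZMod p)) = ∏ j ∈ S, (q j : ZMod p) := by
  classical
  haveI : Fact p.Prime := ⟨hp⟩
  -- `2` is a unit: otherwise `orderOf 2 = 0` contradicts `hcard`
  have h2 : (2 : ZMod p) ≠ 0 := by
    intro h
    rw [h, orderOf_eq_zero_iff'.mpr, mul_zero] at hcard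
    · exact absurd hcard (Nat.not_lt_zero _)
    · intro n hn h0
      rw [zero_pow hn.ne'] at h0
      exact zero_ne_one h0
  set u2 : (ZMod p)ˣ := Units.mk0 (2 : ZMod p) h2 with hu2
  set uq : Fin m → (ZMod p)ˣ := fun j => Units.mk0 (q j : ZMod p) (hq0 j) with huq
  set H : Subgroup (ZMod p)ˣ := Subgroup.zpowers u2 with hH
  -- cardinalities
  have hG : Nat.card (ZMod p)ˣ = p - 1 := by
    rw [Nat.card_eq_fintype_card, ZMod.card_units p]
  have hHcard : Nat.card H = orderOf (2 : ZMod p) := by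
    rw [hH, Nat.card_zpowers, ← orderOf_units, Units.val_mk0]
  have hindex : Nat.card ((ZMod p)ˣ ⧸ H) * orderOf (2 : ZMod p) = p - 1 := by
    rw [← hHcard, ← Subgroup.index_eq_card, Subgroup.index_mul_card, hG]
  -- the map `S ↦ [∏_{j∈S} q_j]` cannot be injective
  set f : Finset (Fin m) → (ZMod p)ˣ ⧸ H := fun S => QuotientGroup.mk (∏ j ∈ S, uq j) with hf
  have hnotinj : ¬ Function.Injective f := by
    intro hinj
    have hle := Nat.card_le_card_of_injective f hinj
    have hdom : Nat.card (Finset (Fin m)) = 2 ^ m := by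
      rw [Nat.card_eq_fintype_card, Fintype.card_finset, Fintype.card_fin]
    rw [hdom] at hle
    have : 2 ^ m * orderOf (2 : ZMod p) ≤ p - 1 := by
      rw [← hindex]
      exact Nat.mul_le_mul_right _ hle
    omega
  obtain ⟨S, T, hST, hne⟩ := Function.not_injective_iff.mp hnotinj
  -- unpack the coset equality
  have hmem : (∏ j ∈ S, uq j)⁻¹ * (∏ j ∈ T, uq j) ∈ H := QuotientGroup.eq.mp hST
  rw [hH] at hmem
  obtain ⟨k, hk⟩ := ((isOfFinOrder_of_finite u2).mem_powers_iff_mem_zpowers).mpr hmem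
  -- `u2 ^ k = (∏_S)⁻¹ * ∏_T`, i.e. `∏_S * u2^k = ∏_T`
  have hk' : u2 ^ k = (∏ j ∈ S, uq j)⁻¹ * (∏ j ∈ T, uq j) := hk
  have hunits : (∏ j ∈ S, uq j) * u2 ^ k = ∏ j ∈ T, uq j := by
    rw [hk', mul_inv_cancel_left]
  refine ⟨T, S, fun h => hne h.symm, k, ?_⟩
  have hval := congrArg Units.val hunits
  simp only [Units.val_mul, Units.val_pow_eq_pow_val, Units.coe_prod, huq, hu2,
    Units.val_mk0] at hval
  rw [mul_comm] at hval
  exact hval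

/-- **A dyadic Bertrand family.** For every `m` there are `m` distinct odd primes
`q_j ∈ (2^(j+1), 2^(j+2)]`; in particular `∏ q_j ≤ 2^(∑ (j+2)) = 2^(m(m+3)/2)`. -/
theorem soloInformed_exists_dyadic_odd_primes (m : ℕ) :
    ∃ q : Fin m → ℕ, (∀ j, (q j).Prime) ∧ (∀ j, 2 ^ (j.val + 1) < q j ∧ q j ≤ 2 ^ (j.val + 2)) ∧
      Function.Injective q ∧ (∀ j, q j ≠ 2) ∧ ∏ j, q j ≤ 2 ^ (∑ j : Fin m, (j.val + 2)) := by
  have hB : ∀ j : Fin m, ∃ q : ℕ, q.Prime ∧ 2 ^ (j.val + 1) < q ∧ q ≤ 2 ^ (j.val + 2) := by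
    intro j
    obtain ⟨q, hq, hlt, hle⟩ := Nat.exists_prime_lt_and_le_two_mul (2 ^ (j.val + 1)) (by positivity)
    exact ⟨q, hq, hlt, by rw [pow_succ]; linarith⟩
  choose q hq hlt hle using hB
  have hinj : Function.Injective q := by
    intro i j hij
    have h1 : 2 ^ (i.val + 1) < 2 ^ (j.val + 2) := by
      calc 2 ^ (i.val + 1) < q i := hlt i
        _ = q j := hij
        _ ≤ 2 ^ (j.val + 2) := hle j
    have h2 : 2 ^ (j.val + 1) < 2 ^ (i.val + 2) := by
      calc 2 ^ (j.val + 1) < q j := hlt j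
        _ = q i := hij.symm
        _ ≤ 2 ^ (i.val + 2) := hle i
    have h1' := (Nat.pow_lt_pow_iff_right (by norm_num : 1 < 2)).mp h1
    have h2' := (Nat.pow_lt_pow_iff_right (by norm_num : 1 < 2)).mp h2
    exact Fin.ext (by omega)
  refine ⟨q, hq, fun j => ⟨hlt j, hle j⟩, hinj, ?_, ?_⟩
  · intro j h
    have := hlt j
    rw [h] at this
    have : 2 ≤ 2 ^ (j.val + 1) := by
      calc 2 = 2 ^ 1 := by norm_num
        _ ≤ 2 ^ (j.val + 1) := Nat.pow_le_pow_right (by norm_num) (by omega)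
    omega
  · calc ∏ j, q j ≤ ∏ j : Fin m, 2 ^ (j.val + 2) :=
          Finset.prod_le_prod (fun j _ => Nat.zero_le _) (fun j _ => hle j)
      _ = 2 ^ (∑ j : Fin m, (j.val + 2)) := Finset.prod_pow_eq_pow_sum _ _ _

/-- The exponent of the dyadic family: `2·∑_{j<m} (j+2) = m(m+3)`. -/
theorem soloInformed_two_mul_sum_fin_add_two (m : ℕ) :
    2 * (∑ j : Fin m, (j.val + 2)) = m * (m + 3) := by
  rw [Fin.sum_univ_eq_sum_range (fun j => j + 2) m]
  induction m with
  | zero => simp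
  | succ n ih =>
    rw [Finset.sum_range_succ, mul_add, ih]
    ring

/-- **The subgroup lever (combinatorial half, kernel-checked).** Suppose a two-`p`-adic-logarithm
bound of Bugeaud–Laurent/Yamada type holds for the pair `(2u/v, u/v)` whenever `u/v` lies in the
subgroup generated by `2` modulo `p`, with main term `C·ord_p(2)·log(max u v)·log(2·max u v)/(log p)^2`
(hypothesis `hH`; the point is the factor `ord_p(2)` in place of Yamada's `p - 1`). Then for any `m`
distinct odd primes `q_j ≠ p` with `2^m·ord_p(2) > p - 1`,
`W(p) ≤ C·ord_p(2)·log(Q)·log(2Q)/(log p)^2 + C'` where `Q = ∏ q_j`. -/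
theorem soloInformed_wieferichExp_le_of_subgroupTwoLogBound {C C' : ℝ} (hC : 0 ≤ C)
    (hH : ∀ p : ℕ, p.Prime → p ≠ 2 → ∀ u v k : ℕ, 0 < u → 0 < v → u ≠ v → Odd u → Odd v →
      ¬ p ∣ u → ¬ p ∣ v → (2 : ZMod p) ^ k * (v : ZMod p) = (u : ZMod p) →
      (padicValNat p (2 ^ (p - 1) - 1) : ℝ) ≤
        C * orderOf (2 : ZMod p) * Real.log ((max u v : ℕ) : ℝ) * Real.log (2 * ((max u v : ℕ) : ℝ))
          / (Real.log p) ^ 2 + C')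
    {p : ℕ} (hp : p.Prime) (hp2 : p ≠ 2) {m : ℕ} (q : Fin m → ℕ)
    (hqprime : ∀ j, (q j).Prime) (hq2 : ∀ j, q j ≠ 2) (hqp : ∀ j, q j ≠ p)
    (hqinj : Function.Injective q) (hcard : p - 1 < 2 ^ m * orderOf (2 : ZMod p)) :
    (padicValNat p (2 ^ (p - 1) - 1) : ℝ) ≤
      C * orderOf (2 : ZMod p) * Real.log ((∏ j, q j : ℕ) : ℝ) * Real.log (2 * ((∏ j, q j : ℕ) : ℝ))
        / (Real.log p) ^ 2 + C' := by
  classical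
  -- the `q_j` are units mod `p`
  have hq0 : ∀ j, (q j : ZMod p) ≠ 0 := by
    intro j h
    have hdvd : p ∣ q j := (ZMod.natCast_eq_zero_iff (q j) p).mp h
    exact hqp j ((Nat.prime_dvd_prime_iff_eq hp (hqprime j)).mp hdvd).symm
  obtain ⟨S, T, hST, k, hk⟩ := soloInformed_exists_quotient_in_zpowers_two hp q hq0 hcard
  -- sub-products determine the index set (distinct primes)
  have hsub : ∀ S T : Finset (Fin m), (∏ j ∈ S, q j) ∣ (∏ j ∈ T, q j) → S ⊆ T := by
    intro S T hST j hj
    have h1 : q j ∣ ∏ i ∈ T, q i := dvd_trans (Finset.dvd_prod_of_mem q hj) hST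
    obtain ⟨i, hi, hqi⟩ := (hqprime j).prime.exists_mem_finset_dvd h1
    have : q j = q i := (Nat.prime_dvd_prime_iff_eq (hqprime j) (hqprime i)).mp hqi
    rwa [hqinj this]
  set u : ℕ := ∏ j ∈ S, q j with hu
  set v : ℕ := ∏ j ∈ T, q j with hv
  have hu0 : 0 < u := Finset.prod_pos (fun j _ => (hqprime j).pos)
  have hv0 : 0 < v := Finset.prod_pos (fun j _ => (hqprime j).pos)
  have huv : u ≠ v := by
    intro h
    apply hST
    exact Finset.Subset.antisymm (hsub S T (by rw [← hu, ← hv, h])) (hsub T S (by rw [← hu, ← hv, h]))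
  have hnot2 : ∀ S : Finset (Fin m), ¬ 2 ∣ ∏ j ∈ S, q j := by
    intro S h
    obtain ⟨j, _, hj⟩ := Nat.prime_two.prime.exists_mem_finset_dvd h
    exact hq2 j ((Nat.prime_dvd_prime_iff_eq Nat.prime_two (hqprime j)).mp hj).symm
  have hnotp : ∀ S : Finset (Fin m), ¬ p ∣ ∏ j ∈ S, q j := by
    intro S h
    obtain ⟨j, _, hj⟩ := hp.prime.exists_mem_finset_dvd h
    exact hqp j ((Nat.prime_dvd_prime_iff_eq hp (hqprime j)).mp hj).symm
  have hoddu : Odd u := Nat.not_even_iff_odd.mp (by rw [even_iff_two_dvd]; exact hnot2 S)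
  have hoddv : Odd v := Nat.not_even_iff_odd.mp (by rw [even_iff_two_dvd]; exact hnot2 T)
  have hrel : (2 : ZMod p) ^ k * (v : ZMod p) = (u : ZMod p) := by
    rw [hu, hv]; push_cast; exact hk
  have hW := hH p hp hp2 u v k hu0 hv0 huv hoddu hoddv (hnotp S) (hnotp T) hrel
  -- compare `max u v` with the full product `Q`
  set Q : ℕ := ∏ j, q j with hQ
  have huQ : u ≤ Q := Finset.prod_le_prod_of_subset_of_one_le' (Finset.subset_univ S)
    (fun j _ _ => (hqprime j).one_lt.le)
  have hvQ : v ≤ Q := Finset.prod_le_prod_of_subset_of_one_le' (Finset.subset_univ T)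
    (fun j _ _ => (hqprime j).one_lt.le)
  have hmaxQ : ((max u v : ℕ) : ℝ) ≤ (Q : ℝ) := by exact_mod_cast max_le huQ hvQ
  have hmax1 : (1 : ℝ) ≤ ((max u v : ℕ) : ℝ) := by exact_mod_cast le_trans hu0 (le_max_left u v)
  have hQ1 : (1 : ℝ) ≤ (Q : ℝ) := le_trans hmax1 hmaxQ
  have hlog1 : Real.log ((max u v : ℕ) : ℝ) ≤ Real.log (Q : ℝ) :=
    Real.log_le_log (by linarith) hmaxQ
  have hlog2 : Real.log (2 * ((max u v : ℕ) : ℝ)) ≤ Real.log (2 * (Q : ℝ)) :=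
    Real.log_le_log (by linarith) (by linarith)
  have hlm0 : 0 ≤ Real.log ((max u v : ℕ) : ℝ) := Real.log_nonneg hmax1
  have hl2m0 : 0 ≤ Real.log (2 * ((max u v : ℕ) : ℝ)) := Real.log_nonneg (by linarith)
  have hlQ0 : 0 ≤ Real.log (Q : ℝ) := Real.log_nonneg hQ1
  have he0 : (0 : ℝ) ≤ (orderOf (2 : ZMod p) : ℝ) := Nat.cast_nonneg _
  have hmain : C * orderOf (2 : ZMod p) * Real.log ((max u v : ℕ) : ℝ)
        * Real.log (2 * ((max u v : ℕ) : ℝ))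
      ≤ C * orderOf (2 : ZMod p) * Real.log (Q : ℝ) * Real.log (2 * (Q : ℝ)) := by
    apply mul_le_mul _ hlog2 hl2m0
    · exact mul_nonneg (mul_nonneg hC he0) hlQ0
    · exact mul_le_mul_of_nonneg_left hlog1 (mul_nonneg hC he0)
  have hdiv := div_le_div_of_nonneg_right hmain (sq_nonneg (Real.log p))
  linarith

end Summit.ABC.ABC.Theorems
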